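import Summits.BirchSwinnertonDyer.BirchSwinnertonDyer.Theorems.UniversalToricDescentSigmaCongruenceAtThreeIffInvariantPair
import Mathlib.NumberTheory.Padics.MahlerBasis
import HarnessLib

/-!
# Node `TwistTruncationMeasure` (crux-ideate g8 on A = `SigmaCongruenceAtThree`, stmt-BirchSwinnertonDyer-27120)

**Idea slug** `twist-truncation-measure` (card `Cruxes/SigmaCongruenceAtThree/Ideas/twist-truncation-measure.md`,
memo `NodeTwistTruncationMeasure.md`).  D-0171 node: a compiling Cruxes file, every piece tagged.

## 0. One paragraph

The registered lead line `Lines/sqrt_toric_functional.lean` reduces A (kernel-checked, BY NAME) to three stubs; its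
hardest stub `stub_sqrtToricFunctional` posits ONE additive functional `Θ : (ℕ → ℤ) →+ R₀⟦T⟧` ("square-root CM-sum
functional", `R₀ = unrIntegers 3`) with (wild)/(twin)/(μ′) identifications, and prices its EXISTENCE part (F1) as
"the tame-level Igusa tower / Serre–Tate `t`-expansion calculus as a PROOF OBJECT (XL)".  This node swaps the
CONSTRUCTION of `Θ`: following the mechanism of Hsieh's `q`-expansion-valued measure [Hsieh2014, Prop. 5.5, proof:
"we denote by `𝓔_{λ,𝔠}(q)` the measure with values in the space of formal `q`-expansions … by the `q`-expansion
principle this measure descends to a measure with values in `V(𝔠, K, ℤ̄_p)`"], the `T3`-depleted toric measure of a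
form `g` is, ball by ball, the CM VALUE of a RESIDUE-CLASS TRUNCATION of the `q`-expansion of `g`:
`μ_g(a + 3^m ℤ₃) = ev(𝟙_{k ≡ a (3^m)}·g)`.  Consequently
* the distribution law, the `U₃`-null support and the Kummer/moment congruences are FINITE `q`-EXPANSION IDENTITIES
  (§1–§2, PROVED here for every additive `ev`), not Serre–Tate geometry;
* the measure-level congruence "`g ≡ g′ (mod 3)` coefficientwise ⟹ `μ_g ≡ μ_{g′} (mod 3R₀)` ball by ball, hence
  `Θ g ≡ Θ g′ (mod 𝔪R₀⟦T⟧)` AS SERIES" is FREE (§2–§4, PROVED): the `1/φ(3^m) = 1/(2·3^{m−1})` denominators of finite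
  Fourier inversion — the reason the value-level cards (deep-conductor-stability, lambda-scale-blind, one-deep-layer,
  gauss-extraction) need a rigidity lemma to climb from values at characters of conductor `3^m` to the series — never
  appear, because balls, not characters, are evaluated; in nature the truncated forms
  `g_{m,a} = φ(3^m)⁻¹ Σ_ψ ψ̄(a) g⊗ψ` have INTEGRAL `q`-expansions, so Katz's flatness of the `q`-expansion map
  (`𝕍(L,W)/3^m ↪ (W/3^m)⟦q⟧`, [Katz1975], [Gouvea1988, §I.3]) absorbs the denominators once and for all;
* the only geometric input left in F1 is ONE additive evaluation functional `ev` ("value at the ordinary CM test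
  object `x_𝔞` of the `3`-adic modular form of tame level `L` with the given `q`-expansion", Katz) and the purely
  `3`-adic AMICE PACKAGING `𝒜` of ball values into `R₀⟦T⟧` (§5 — constructed and PROVED here: `amice`).
`Θ := 𝒜 ∘ ballValues ev` (§4, `thetaOf`, DEFINED) is then the witness shape of the line's `∃ Θ`, and F1 ceases to be
a proof object: F = `⟨thetaOf ev 𝒜, e, he, (wild), (twin), (μ′)⟩` with (wild)/(twin)/(μ′) the line's F2/F3 verbatim.

## 1. Pieces and tags (D-0171)

* §1 `trunc`, `sum_range_trunc` (partition), `trunc_eq_sum_trunc_succ` (tower law), `trunc_eq_zero_of_depleted`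
  (`U₃`-null support: a `3`-depleted `q`-expansion has no mass on `3 ∣ a`), `theta`,
  `exists_sum_pow_smul_trunc_sub_theta` (moment congruence `Σ_a aⁿ·𝟙_a g ≡ θⁿ g (mod 3^m)`) — support, **PROVED**,
  tag WEAKER (pure `q`-expansion algebra; this is the content of "the Fourier coefficients form measures" in
  [Hsieh2014, Prop. 5.5]).
* §2 `ballValues ev`, `distributions M` (the ball-value presentation of `M`-valued distributions on `ℤ₃`),
  `ballValues_mem_distributions` (AUTOMATIC distribution law), `sum_range_ballValues` (total mass `= ev g`),
  `ballValues_eq_zero_of_depleted`, `exists_ballValues_sub_eq_smul` (congruence transfer `mod 3`, FREE),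
  `exists_moment_sub_ev_theta` (moments `≡ ev(θⁿg) (mod 3^m)`: the interpolation data at weight-`n` characters are CM
  values of `θⁿ g` — the entry point of [Katz1978, 2.4–2.6]/explicit Waldspurger) — support, **PROVED** for every
  additive `ev : (ℕ → ℤ) →+ M`, tag WEAKER.
* §3 `R₀`-specialisation: `norm_ballValues_sub_lt_one` — **PROVED**.
* §4 `thetaOf ev 𝒜 := 𝒜 ∘ ballValuesDist ev` (DEFINED) and `thetaOf_congr` (**PROVED**): the line's F1 as a
  DEFINITION.  Tag: CONSTRUCTION SWAP for `stub_sqrtToricFunctional` (F1) — not a restatement of A, not of F: it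
  produces the `∃ Θ` witness, it does not assert (wild)/(twin).
* §5 `AmicePackaging` — tag WEAKER (pure `3`-adic analysis, no curve) — **CONSTRUCTED and PROVED here**
  (`amice`, `amicePackaging`): Riemann sums of `x ↦ C(x,n)` against an `R₀`-valued distribution converge in the
  complete ring `R₀` (`isClosed_unrIntegers`) at the Kummer rate `3^{-(m−v₃(n!))}` (`pow_dvd_choose_sub_choose`:
  `3^{m−v₃(n!)} ∣ C(b,n) − C(b′,n)` for `b ≡ b′ (3^m)`, via `descPochhammer ℤ n`); additivity by uniqueness of limits.
  Hence `thetaAmice ev := amice ∘ ballValues ev` is a CANONICAL `Θ` attached to `ev` alone, and JC-as-series for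
  it is `thetaAmice_congr` (PROVED).
* Leaves NOT typed here (same vocabulary gap as every Katz-road card: CM test objects / `𝕍(L,W)` are not tree
  objects; no interface is posited, the line's pure-extension trick keeps `ev` on all of `ℤ^ℕ`):
  - (EV) KATZ EVALUATION — UNDECIDED→ATTACKABLE(print): `ev_𝔞 : 𝕍(L, W) → W`, `W = R₀`, evaluation at the ordinary CM
    test object `x_𝔞` (trivialised: `3` splits in `K`), INTEGRAL on `q`-integral elements; classical forms of level
    `3^k·L` with `W`-integral `q`-expansion lie in `𝕍(L,W)` [Katz1975] — this absorbs the wild level `27 ∣ N` AND the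
    twist-truncations `g_{m,a}` (level `9^m L`); flatness `𝕍/3^m ↪ (W/3^m)⟦q⟧` [Katz1975; Gouvea1988 §I.3].
  - (KJ′) WILD/TWIN IDENTIFICATION for `Θ := thetaOf ev 𝒜` — = the line's F2/F3, UNDECIDED→ATTACKABLE-by-port: the
    moments of `Σ_𝔞 λ(𝔞)[σ_𝔞]·μ_{g,𝔞}` are the CM sums `Σ_𝔞 λφ_n(𝔞)·θⁿg^{[T3]}(x_𝔞)` (§2 `exists_moment_sub_ev_theta`
    + [Katz1978, 2.6.7] `θⁿ ↔ δⁿ` at CM points), whose squares are the `T3`-depleted central values by explicit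
    Waldspurger with the UNIVERSAL depleted Kirillov datum `𝟙_{𝒪_v^×}·χ_w(a⁻¹)` at every `v ∈ T ∪ {3}` (split rows:
    [Hsieh2014, Prop. 3.5] is a purely local computation valid for ANY `π_v`, so neither the wild type of `π_{E,3}` nor
    the `T`-types of `E, E′` enter; tree: `Hsieh2014.thmA_exists_isHsiehLFunction_unrPeriod_anyLevel`); matching the
    frames' `P_T`-currency is g7's EF/GR bookkeeping (`NodeWeightJetBinomial`).
  - (H) Hecke congruence of depleted `q`-expansions = line stub `stub_heckeCongruence` (M); (B) Thm B = item 27933.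

## 2. Why novel (problem-relative) and what is NOT new

No pool card or line builds the measure from VALUES OF TRUNCATED FORMS: sqrt-toric-functional / weight-jet-binomial /
universal-period-pair use the Serre–Tate `t`-expansion (Castella–Hsieh, Kriz–Li) and price it as a proof object; the
four value-level cards evaluate at CHARACTERS and pay a rigidity lemma for the `φ(3^m)⁻¹`; heegner-log-anchor uses
the single value `T = 0`; eisenstein-degree-shadow degenerates the form.  Here the lever is «ball = truncated form;
Katz flatness absorbs the Fourier denominators», which makes JC-as-series a corollary of the value-level engine with
no rigidity lemma and no Serre–Tate layer.  NOT new in print: it is exactly the Katz–Hida–Tilouine/Hsieh mechanism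
of `q`-expansion-valued measures ([Hsieh2014, Prop. 5.5], [corpus:paper-arxiv-1112.1580 p.23]); new only ON THIS
CRUX (search log in the memo: corpus fts+vec and galaxy, no hit joining it to congruences of anticyclotomic
`L`-functions at additive primes).

## 3. Barrier note (g8, obstruction side — NOT a card): base-change resolution of the wild type is DOMINATED

Resolving `π_{E,3}` (supercuspidal/wild principal series, `Φ ∈ {C₃, C₆, C₃⋊C₄}`) by a totally real solvable `F` with
`E_F` good at `𝔮 ∣ 3` buys nothing for A: (i) Artin formalism `L(E_F/KF, φ∘N) = ∏_χ L(E ⊗ χ/K, φ)` always leaves a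
WILD piece (`χ` of `3`-power conductor), so descending `λ` needs `λ(frame E) = λ(frame E⊗χ)`-type input = two wild
KJ's; (ii) Hsieh's `μ = 0` (Thm. B/Thm. 2) requires `p` unramified in `F` [corpus:paper-arxiv-1112.1580 p.4 L31],
false by design; (iii) the Katz road over `F` needs the Hilbert Igusa tower at a prime ramified in `F` — strictly
heavier than over `ℚ`, while at a SPLIT prime the wild type is already invisible to the toric machinery (split-row
universality, in the pool).  Cube-root descent of `λ` itself is harmless (`Frob₃` injective on `𝔽̄₃⟦T⟧`:
`3λ = 3λ′ ⟹ λ = λ′`), so the obstruction is (i)–(iii), not the descent.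

Disproof used: none exists for this crux (`ledger crux ls stmt-BirchSwinnertonDyer-27120`, 2026-08-30: no
`Disproof.lean`, no `Negative/`); `ledger negatives --problem BirchSwinnertonDyer`: nothing on Σ-congruence/frames.
-/

set_option autoImplicit false
set_option linter.dupNamespace false

noncomputable section

open scoped Classical

namespace Summit.BirchSwinnertonDyer.BirchSwinnertonDyer.Cruxes.SigmaCongruenceAtThree.TwistTruncationMeasure

open Literature.NumberTheory.EllipticCurves
open Summit.BirchSwinnertonDyer.BirchSwinnertonDyer.Theorems.UniversalToricDescentNormProfile
open Finset

/-! ### §1 Residue-class truncations of integer `q`-expansions -/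

/-- **Residue-class truncation** `g ↦ 𝟙_{k ≡ a (mod 3^m)}·g` of an integer `q`-expansion `g : ℕ → ℤ`, the residue
named by `a < 3^m` (for `a ≥ 3^m` the truncation is `0`).  In nature: the `q`-expansion of the twisted form
`g_{m,a} = φ(3^m)⁻¹ Σ_{ψ mod 3^m} ψ̄(a)·g⊗ψ` (for `3 ∤ a`), an element of `𝕍(L,W)` by Katz flatness.
[cite: Hsieh2014, Prop. 5.3 and proof of Prop. 5.5] -/
def trunc (m a : ℕ) : (ℕ → ℤ) →+ (ℕ → ℤ) where
  toFun g k := if k % 3 ^ m = a then g k else 0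
  map_zero' := by
    funext k
    simp
  map_add' g g' := by
    funext k
    by_cases h : k % 3 ^ m = a <;> simp [h]

@[simp] theorem trunc_apply (m a : ℕ) (g : ℕ → ℤ) (k : ℕ) :
    trunc m a g k = if k % 3 ^ m = a then g k else 0 := rfl

/-- Residues `a ≥ 3^m` carry nothing. [folklore] -/
theorem trunc_of_le (m a : ℕ) (ha : 3 ^ m ≤ a) (g : ℕ → ℤ) : trunc m a g = 0 := by
  funext k
  have hk : k % 3 ^ m < 3 ^ m := Nat.mod_lt _ (pow_pos (by norm_num) m)
  have hne : k % 3 ^ m ≠ a := fun h ↦ absurd (h ▸ hk) (not_lt.mpr ha)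
  simp [hne]

/-- **Partition of unity**: `Σ_{a < 3^m} 𝟙_a·g = g`. [folklore] -/
theorem sum_range_trunc (m : ℕ) (g : ℕ → ℤ) : ∑ a ∈ range (3 ^ m), trunc m a g = g := by
  funext k
  rw [Finset.sum_apply]
  have hk : k % 3 ^ m < 3 ^ m := Nat.mod_lt _ (pow_pos (by norm_num) m)
  simp [Finset.sum_ite_eq, Finset.mem_range, hk]

/-- **Tower law** (the distribution relation at the level of truncations): the class `a (mod 3^m)` is the disjoint
union of the classes `b (mod 3^{m+1})` with `b ≡ a (mod 3^m)`. [folklore] -/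
theorem trunc_eq_sum_trunc_succ (m a : ℕ) (g : ℕ → ℤ) :
    trunc m a g = ∑ b ∈ (range (3 ^ (m + 1))).filter (fun b ↦ b % 3 ^ m = a), trunc (m + 1) b g := by
  funext k
  rw [Finset.sum_apply]
  have hmod : k % 3 ^ (m + 1) % 3 ^ m = k % 3 ^ m := Nat.mod_mod_of_dvd k (pow_dvd_pow 3 m.le_succ)
  have hlt : k % 3 ^ (m + 1) < 3 ^ (m + 1) := Nat.mod_lt _ (pow_pos (by norm_num) _)
  by_cases h : k % 3 ^ m = a
  · simp [Finset.sum_ite_eq, Finset.mem_filter, Finset.mem_range, hmod, h, hlt]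
  · simp [Finset.sum_ite_eq, Finset.mem_filter, Finset.mem_range, hmod, h]

/-- **`U₃`-null support**: a `3`-depleted `q`-expansion (`g k = 0` whenever `3 ∣ k`) has no mass on residues
`a ≡ 0 (mod 3)` at any level `m ≥ 1` — the measure lives on `ℤ₃^×`. [cite: Hsieh2014, proof of Prop. 5.5
("`𝓔_{λ,𝔠}` has support in `Γ′` by definition")] -/
theorem trunc_eq_zero_of_depleted {g : ℕ → ℤ} (hg : ∀ k, 3 ∣ k → g k = 0) {m a : ℕ} (hm : 1 ≤ m)
    (ha : 3 ∣ a) : trunc m a g = 0 := by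
  funext k
  simp only [trunc_apply, Pi.zero_apply]
  split_ifs with h
  · apply hg
    have h3 : k % 3 ^ m % 3 = k % 3 := Nat.mod_mod_of_dvd k (dvd_pow_self 3 (by omega))
    rw [h] at h3
    obtain ⟨c, rfl⟩ := ha
    omega
  · rfl

/-- **The weight operator `θⁿ` on `q`-expansions**: `(θⁿ g)(k) = kⁿ·g(k)`. [cite: Katz1978, (2.6)] -/
def theta (n : ℕ) : (ℕ → ℤ) →+ (ℕ → ℤ) where
  toFun g k := (k : ℤ) ^ n * g k
  map_zero' := by
    funext k
    simp
  map_add' g g' := by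
    funext k
    simp [mul_add]

@[simp] theorem theta_apply (n : ℕ) (g : ℕ → ℤ) (k : ℕ) : theta n g k = (k : ℤ) ^ n * g k := rfl

/-- **Moment congruence** (Kummer-type, at the `q`-expansion level): the level-`m` Riemann sum of `aⁿ` against the
truncations is `θⁿ g` up to `3^m`: `Σ_{a<3^m} aⁿ·𝟙_a g − θⁿ g ∈ 3^m·ℤ^ℕ`. [folklore; cf. Hsieh2014 proof of Prop. 5.5,
`∫ φ̂ d𝓔(q) = θ^m 𝐟*_{λφ}(q)`] -/
theorem exists_sum_pow_smul_trunc_sub_theta (m n : ℕ) (g : ℕ → ℤ) :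
    ∃ y : ℕ → ℤ, (∑ a ∈ range (3 ^ m), ((a : ℤ) ^ n) • trunc m a g) - theta n g = ((3 : ℤ) ^ m) • y := by
  have key : ∀ k : ℕ, ∃ c : ℤ, ((k % 3 ^ m : ℕ) : ℤ) ^ n * g k - (k : ℤ) ^ n * g k = (3 : ℤ) ^ m * c := by
    intro k
    have h1 : ((k % 3 ^ m : ℕ) : ℤ) ≡ (k : ℤ) [ZMOD ((3 ^ m : ℕ) : ℤ)] := by
      rw [Int.natCast_mod]
      exact Int.mod_modEq _ _
    have h2 := (h1.pow n).mul_right (g k)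
    have h3 : ((3 : ℤ) ^ m) ∣ ((k % 3 ^ m : ℕ) : ℤ) ^ n * g k - (k : ℤ) ^ n * g k := by
      have := h2.symm.dvd
      push_cast at this
      exact this
    exact h3
  choose c hc using key
  refine ⟨c, funext fun k ↦ ?_⟩
  have hk : k % 3 ^ m < 3 ^ m := Nat.mod_lt _ (pow_pos (by norm_num) m)
  simp only [Pi.sub_apply, Finset.sum_apply, Pi.smul_apply, trunc_apply, smul_eq_mul, mul_ite, mul_zero,
    theta_apply]
  rw [Finset.sum_ite_eq]
  simp only [Finset.mem_range, hk, if_true]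
  exact hc k

/-! ### §2 Ball values of an additive functional: the distribution law and the congruence transfer are automatic -/

section BallValues

variable {M : Type*} [AddCommGroup M]

/-- **Ball values**: `(m, a) ↦ ev(𝟙_{a (3^m)}·g)` — in nature `μ_{g,𝔞}(a + 3^m ℤ₃) := ev_𝔞(g_{m,a})`, the value of the
truncated form at the CM test object; additive in `g` by construction. [cite: Hsieh2014, proof of Prop. 5.5] -/
def ballValues (ev : (ℕ → ℤ) →+ M) : (ℕ → ℤ) →+ (ℕ → ℕ → M) where
  toFun g m a := ev (trunc m a g)
  map_zero' := by
    funext m a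
    simp
  map_add' g g' := by
    funext m a
    simp [map_add]

@[simp] theorem ballValues_apply (ev : (ℕ → ℤ) →+ M) (g : ℕ → ℤ) (m a : ℕ) :
    ballValues ev g m a = ev (trunc m a g) := rfl

variable (M) in
/-- **`M`-valued distributions on `ℤ₃` presented by ball values**: tower-compatible families `ν m a = ν(a + 3^m ℤ₃)`
supported on the residues `a < 3^m`.  An additive subgroup of all families. [folklore] -/
def distributions : AddSubgroup (ℕ → ℕ → M) where
  carrier := {ν | (∀ m a, ν m a = ∑ b ∈ (range (3 ^ (m + 1))).filter (fun b ↦ b % 3 ^ m = a), ν (m + 1) b) ∧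
    ∀ m a, 3 ^ m ≤ a → ν m a = 0}
  zero_mem' := by
    refine ⟨fun m a ↦ ?_, fun m a _ ↦ rfl⟩
    simp
  add_mem' := by
    rintro ν ν' ⟨h1, h2⟩ ⟨h1', h2'⟩
    refine ⟨fun m a ↦ ?_, fun m a ha ↦ ?_⟩
    · simp only [Pi.add_apply]
      rw [h1 m a, h1' m a, ← Finset.sum_add_distrib]
    · simp [h2 m a ha, h2' m a ha]
  neg_mem' := by
    rintro ν ⟨h1, h2⟩
    refine ⟨fun m a ↦ ?_, fun m a ha ↦ ?_⟩
    · simp only [Pi.neg_apply]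
      rw [h1 m a, ← Finset.sum_neg_distrib]
    · simp [h2 m a ha]

theorem mem_distributions_iff (ν : ℕ → ℕ → M) :
    ν ∈ distributions M ↔
      (∀ m a, ν m a = ∑ b ∈ (range (3 ^ (m + 1))).filter (fun b ↦ b % 3 ^ m = a), ν (m + 1) b) ∧
        ∀ m a, 3 ^ m ≤ a → ν m a = 0 := Iff.rfl

/-- **The distribution law is automatic**: ball values of ANY additive functional form a distribution — no
Serre–Tate coordinates, no Amice transform of a `t`-expansion. [folklore; this node] -/
theorem ballValues_mem_distributions (ev : (ℕ → ℤ) →+ M) (g : ℕ → ℤ) :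
    ballValues ev g ∈ distributions M := by
  refine ⟨fun m a ↦ ?_, fun m a ha ↦ ?_⟩
  · simp only [ballValues_apply]
    rw [trunc_eq_sum_trunc_succ, map_sum]
  · simp [trunc_of_le m a ha]

/-- Ball values as an additive map INTO the distributions. -/
def ballValuesDist (ev : (ℕ → ℤ) →+ M) : (ℕ → ℤ) →+ distributions M :=
  (ballValues ev).codRestrict (distributions M) (ballValues_mem_distributions ev)

@[simp] theorem coe_ballValuesDist_apply (ev : (ℕ → ℤ) →+ M) (g : ℕ → ℤ) :
    ((ballValuesDist ev g : distributions M) : ℕ → ℕ → M) = ballValues ev g := rfl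

/-- **Total mass** `μ_g(ℤ₃) = ev(g)`. [folklore] -/
theorem sum_range_ballValues (ev : (ℕ → ℤ) →+ M) (g : ℕ → ℤ) (m : ℕ) :
    ∑ a ∈ range (3 ^ m), ballValues ev g m a = ev g := by
  simp only [ballValues_apply]
  rw [← map_sum, sum_range_trunc]

/-- **Support on units** for depleted `q`-expansions. [cite: Hsieh2014, proof of Prop. 5.5] -/
theorem ballValues_eq_zero_of_depleted (ev : (ℕ → ℤ) →+ M) {g : ℕ → ℤ} (hg : ∀ k, 3 ∣ k → g k = 0)
    {m a : ℕ} (hm : 1 ≤ m) (ha : 3 ∣ a) : ballValues ev g m a = 0 := by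
  simp [trunc_eq_zero_of_depleted hg hm ha]

/-- **Congruence transfer, for free**: coefficientwise `g ≡ g′ (mod 3)` ⟹ `μ_g − μ_{g′} = 3·μ_h` ball by ball —
the measure-level form of JC, with no rigidity lemma and no `φ(3^m)⁻¹`. [this node] -/
theorem exists_ballValues_sub_eq_smul (ev : (ℕ → ℤ) →+ M) {g g' : ℕ → ℤ}
    (h : ∀ k, (3 : ℤ) ∣ g k - g' k) :
    ∃ h' : ℕ → ℤ, ballValues ev g - ballValues ev g' = (3 : ℤ) • ballValues ev h' := by
  choose c hc using h
  refine ⟨c, ?_⟩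
  have hfun : g - g' = (3 : ℤ) • (c : ℕ → ℤ) := by
    funext k
    simp only [Pi.sub_apply, Pi.smul_apply, smul_eq_mul]
    exact hc k
  rw [← map_sub, hfun, map_zsmul]

/-- **Moments are CM values of `θⁿg` up to `3^m`**: `Σ_{a<3^m} aⁿ·μ_g(a + 3^m) − ev(θⁿ g) ∈ 3^m·M` — the weight-`n`
interpolation data of the packaged series are the values `ev(θⁿ g)`, where [Katz1978, 2.6.7] (`θⁿ ↔ δⁿ` at CM
points) and explicit Waldspurger take over. [folklore; this node] -/
theorem exists_moment_sub_ev_theta (ev : (ℕ → ℤ) →+ M) (g : ℕ → ℤ) (m n : ℕ) :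
    ∃ y : M, (∑ a ∈ range (3 ^ m), ((a : ℤ) ^ n) • ballValues ev g m a) - ev (theta n g) = ((3 : ℤ) ^ m) • y := by
  obtain ⟨y, hy⟩ := exists_sum_pow_smul_trunc_sub_theta m n g
  refine ⟨ev y, ?_⟩
  have hsum : ∑ a ∈ range (3 ^ m), ((a : ℤ) ^ n) • ballValues ev g m a =
      ev (∑ a ∈ range (3 ^ m), ((a : ℤ) ^ n) • trunc m a g) := by
    rw [map_sum]
    refine Finset.sum_congr rfl fun a _ ↦ ?_
    rw [map_zsmul, ballValues_apply]
  rw [hsum, ← map_sub, hy, map_zsmul]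

end BallValues

/-! ### §3 `R₀`-valued ball values: the congruence in norms -/

/-- `‖3‖ < 1` in `ℂ₃`. [folklore] -/
theorem norm_three_lt_one : ‖((3 : ℕ) : ℂ_[3])‖ < 1 := by
  haveI : Fact (Nat.Prime 3) := ⟨Nat.prime_three⟩
  have h : ‖((3 : ℕ) : ℂ_[3])‖ = ‖((3 : ℕ) : ℚ_[3])‖ := by
    rw [← map_natCast (algebraMap ℚ_[3] ℂ_[3]) 3, norm_algebraMap']
  rw [h]
  exact Padic.norm_p_lt_one

/-- `3·R₀ ⊆ 𝔪_{R₀}`. [folklore] -/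
theorem norm_coe_zsmul_three_lt_one (x : unrIntegers 3) :
    ‖((((3 : ℤ) • x : unrIntegers 3)) : ℂ_[3])‖ < 1 := by
  rw [zsmul_eq_mul, Subring.coe_mul]
  have h3 : (((3 : ℤ) : unrIntegers 3) : ℂ_[3]) = ((3 : ℕ) : ℂ_[3]) := by
    push_cast
    rfl
  rw [norm_mul, h3]
  calc ‖((3 : ℕ) : ℂ_[3])‖ * ‖(x : ℂ_[3])‖
      ≤ ‖((3 : ℕ) : ℂ_[3])‖ * 1 :=
        mul_le_mul_of_nonneg_left
          (Summit.BirchSwinnertonDyer.Rank1Residual.X11b.Halves.norm_coe_unrIntegers_le_one 3 x) (norm_nonneg _)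
    _ < 1 := by
        rw [mul_one]
        exact norm_three_lt_one

/-- **JC at the level of measures, in `R₀`**: congruent depleted `q`-expansions have ball values congruent
`mod 𝔪_{R₀}` at EVERY ball — uniformly in the level `m`. [this node] -/
theorem norm_ballValues_sub_lt_one (ev : (ℕ → ℤ) →+ unrIntegers 3) {g g' : ℕ → ℤ}
    (h : ∀ k, (3 : ℤ) ∣ g k - g' k) (m a : ℕ) :
    ‖((ballValues ev g m a - ballValues ev g' m a : unrIntegers 3) : ℂ_[3])‖ < 1 := by
  obtain ⟨h', H⟩ := exists_ballValues_sub_eq_smul ev h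
  have Hma : ballValues ev g m a - ballValues ev g' m a = (3 : ℤ) • ballValues ev h' m a := by
    have := congr_fun (congr_fun H m) a
    simpa using this
  rw [Hma]
  exact norm_coe_zsmul_three_lt_one _

/-! ### §4 `Θ := 𝒜 ∘ ballValues ev` — the line's F1 as a definition -/

/-- **The square-root functional, constructed**: given the CM evaluation `ev` (Katz) and an additive Amice packaging
`𝒜` of `R₀`-valued distributions into `R₀⟦T⟧`, `Θ := 𝒜 ∘ ballValues ev` is an additive map
`(ℕ → ℤ) →+ R₀⟦T⟧` — the witness shape of `stub_sqrtToricFunctional`'s `∃ Θ`. [this node; mechanism of Hsieh2014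
Prop. 5.5 + §5.5] -/
def thetaOf (ev : (ℕ → ℤ) →+ unrIntegers 3) (𝒜 : distributions (unrIntegers 3) →+ UnrSeries 3) :
    (ℕ → ℤ) →+ UnrSeries 3 :=
  𝒜.comp (ballValuesDist ev)

theorem thetaOf_apply (ev : (ℕ → ℤ) →+ unrIntegers 3) (𝒜 : distributions (unrIntegers 3) →+ UnrSeries 3)
    (g : ℕ → ℤ) : thetaOf ev 𝒜 g = 𝒜 (ballValuesDist ev g) := rfl

/-- **Linearity turns coefficientwise divisibility by `3` into a congruence `mod 𝔪_{R₀}` of the images** — for ANY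
additive `Θ` (the line's lemma, reproved here to keep the node self-contained). [folklore] -/
theorem forall_norm_coeff_sub_lt_one_of_dvd (Θ : (ℕ → ℤ) →+ UnrSeries 3) {g g' : ℕ → ℤ}
    (hdvd : ∀ n, (3 : ℤ) ∣ g n - g' n) :
    ∀ i, ‖((PowerSeries.coeff i (Θ g - Θ g') : unrIntegers 3) : ℂ_[3])‖ < 1 := by
  choose h hh using hdvd
  have hfun : g - g' = (3 : ℤ) • (h : ℕ → ℤ) := by
    funext n
    simp only [Pi.sub_apply, Pi.smul_apply, smul_eq_mul]
    exact hh n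
  intro i
  rw [← map_sub, hfun, map_zsmul, map_zsmul]
  exact norm_coe_zsmul_three_lt_one _

/-- **JC as SERIES for the constructed functional**: `Θ g ≡ Θ g′ (mod 𝔪R₀⟦T⟧)` from `g ≡ g′ (mod 3)`. [this node] -/
theorem thetaOf_congr (ev : (ℕ → ℤ) →+ unrIntegers 3) (𝒜 : distributions (unrIntegers 3) →+ UnrSeries 3)
    {g g' : ℕ → ℤ} (h : ∀ k, (3 : ℤ) ∣ g k - g' k) :
    ∀ i, ‖((PowerSeries.coeff i (thetaOf ev 𝒜 g - thetaOf ev 𝒜 g') : unrIntegers 3) : ℂ_[3])‖ < 1 :=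
  forall_norm_coeff_sub_lt_one_of_dvd (thetaOf ev 𝒜) h

/-! ### §5 Amice packaging of ball-value distributions — CONSTRUCTED and PROVED (pure `3`-adic analysis)

The additive Amice–Mahler transform `𝒜 : distributions(R₀) →+ R₀⟦T⟧`: the `n`-th coefficient of `𝒜 ν` is
`∫ C(x,n) dν(x) := lim_m Σ_{a<3^m} C(a,n)·ν(a + 3^m ℤ₃)`, with the Kummer-type rate `3^{-(m − v₃(n!))}`.  No
hypothesis beyond the distribution law; integrality is by type (`R₀` is closed in `ℂ₃`). -/

section Amice

open Filter Topology

/-- Level-`m` Riemann sum of the Mahler function `x ↦ C(x,n)` against the family `ν`, read in `ℂ₃`. -/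
def riemann (ν : ℕ → ℕ → unrIntegers 3) (n m : ℕ) : ℂ_[3] :=
  ∑ a ∈ range (3 ^ m), ((a.choose n : ℕ) : ℂ_[3]) * ((ν m a : unrIntegers 3) : ℂ_[3])

theorem riemann_mem (ν : ℕ → ℕ → unrIntegers 3) (n m : ℕ) : riemann ν n m ∈ unrIntegers 3 := by
  unfold riemann
  refine Subring.sum_mem _ fun a _ ↦ Subring.mul_mem _ ?_ (ν m a).2
  exact natCast_mem (unrIntegers 3) (a.choose n)

theorem riemann_add (ν ν' : ℕ → ℕ → unrIntegers 3) (n m : ℕ) :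
    riemann (ν + ν') n m = riemann ν n m + riemann ν' n m := by
  simp [riemann, Finset.sum_add_distrib, mul_add]

theorem riemann_zero (n m : ℕ) : riemann 0 n m = 0 := by
  simp [riemann]

/-- **The integer lemma behind the Kummer congruences of Mahler coefficients**: `b ≡ b′ (mod 3^m)` ⟹
`3^{m − v₃(n!)} ∣ C(b,n) − C(b′,n)` (`n!·C(x,n)` is the integer polynomial `descPochhammer ℤ n`). [folklore] -/
theorem pow_dvd_choose_sub_choose (n m : ℕ) {b b' : ℕ} (h : b % 3 ^ m = b' % 3 ^ m) :
    ((3 : ℕ) : ℤ) ^ (m - padicValNat 3 n.factorial) ∣ ((b.choose n : ℕ) : ℤ) - ((b'.choose n : ℕ) : ℤ) := by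
  haveI : Fact (Nat.Prime 3) := ⟨Nat.prime_three⟩
  have h1 : ((3 ^ m : ℕ) : ℤ) ∣ (b' : ℤ) - (b : ℤ) := Nat.modEq_iff_dvd.mp h
  have h2 : (b' : ℤ) - (b : ℤ) ∣
      (n.factorial : ℤ) * (((b'.choose n : ℕ) : ℤ) - ((b.choose n : ℕ) : ℤ)) := by
    have := Polynomial.sub_dvd_eval_sub (b' : ℤ) (b : ℤ) (descPochhammer ℤ n)
    rw [descPochhammer_eval_eq_descFactorial ℤ b' n, descPochhammer_eval_eq_descFactorial ℤ b n,
      Nat.descFactorial_eq_factorial_mul_choose, Nat.descFactorial_eq_factorial_mul_choose] at this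
    push_cast at this
    rwa [← mul_sub] at this
  have h3 : ((3 : ℕ) : ℤ) ^ m ∣ (n.factorial : ℤ) * (((b'.choose n : ℕ) : ℤ) - ((b.choose n : ℕ) : ℤ)) := by
    have := h1.trans h2
    exact_mod_cast this
  rw [dvd_sub_comm]
  set d : ℤ := ((b'.choose n : ℕ) : ℤ) - ((b.choose n : ℕ) : ℤ) with hd
  by_cases hd0 : d = 0
  · rw [hd0]
    exact dvd_zero _
  have hfact : (n.factorial : ℤ) ≠ 0 := by exact_mod_cast n.factorial_ne_zero
  have hle : m ≤ padicValInt 3 ((n.factorial : ℤ) * d) := by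
    rcases (padicValInt_dvd_iff m _).mp h3 with h0 | hle
    · exact absurd h0 (mul_ne_zero hfact hd0)
    · exact hle
  rw [padicValInt.mul hfact hd0] at hle
  have hv : padicValInt 3 (n.factorial : ℤ) = padicValNat 3 n.factorial := by
    simp [padicValInt]
  refine (padicValInt_dvd_iff _ d).mpr (Or.inr ?_)
  omega

/-- `3^k ∣ d` in `ℤ` ⟹ `‖d‖ ≤ 3^{-k}` in `ℂ₃`. [folklore] -/
theorem norm_intCast_le_of_pow_dvd {d : ℤ} {k : ℕ} (h : ((3 : ℕ) : ℤ) ^ k ∣ d) :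
    ‖(d : ℂ_[3])‖ ≤ (3 : ℝ) ^ (-(k : ℤ)) := by
  haveI : Fact (Nat.Prime 3) := ⟨Nat.prime_three⟩
  have h1 : ‖(d : ℚ_[3])‖ ≤ ((3 : ℕ) : ℝ) ^ (-(k : ℤ)) :=
    (Padic.norm_int_le_pow_iff_dvd d k).mpr (by exact_mod_cast h)
  have h2 : ‖(d : ℂ_[3])‖ = ‖(d : ℚ_[3])‖ := by
    rw [← map_intCast (algebraMap ℚ_[3] ℂ_[3]) d, norm_algebraMap']
  rw [h2]
  exact_mod_cast h1

/-- Refinement: the level-`m` Riemann sum re-read at level `m+1` through the distribution law. [folklore] -/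
theorem riemann_eq_sum_succ (ν : ℕ → ℕ → unrIntegers 3) (hν : ν ∈ distributions (unrIntegers 3)) (n m : ℕ) :
    riemann ν n m = ∑ b ∈ range (3 ^ (m + 1)),
      (((b % 3 ^ m).choose n : ℕ) : ℂ_[3]) * ((ν (m + 1) b : unrIntegers 3) : ℂ_[3]) := by
  have hmaps : ∀ b ∈ range (3 ^ (m + 1)), b % 3 ^ m ∈ range (3 ^ m) :=
    fun b _ ↦ Finset.mem_range.2 (Nat.mod_lt _ (pow_pos (by norm_num) m))
  calc riemann ν n m
      = ∑ a ∈ range (3 ^ m), ∑ b ∈ range (3 ^ (m + 1)) with b % 3 ^ m = a,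
          (((b % 3 ^ m).choose n : ℕ) : ℂ_[3]) * ((ν (m + 1) b : unrIntegers 3) : ℂ_[3]) := by
        unfold riemann
        refine Finset.sum_congr rfl fun a _ ↦ ?_
        rw [(mem_distributions_iff ν).1 hν |>.1 m a]
        push_cast
        rw [Finset.mul_sum]
        refine Finset.sum_congr rfl fun b hb ↦ ?_
        rw [(Finset.mem_filter.1 hb).2]
    _ = _ := Finset.sum_fiberwise_of_maps_to hmaps _

/-- **One-step Kummer bound**: `‖S_{m+1} − S_m‖ ≤ 3^{-(m − v₃(n!))}` (ultrametric). [folklore] -/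
theorem norm_riemann_succ_sub_le (ν : ℕ → ℕ → unrIntegers 3) (hν : ν ∈ distributions (unrIntegers 3))
    (n m : ℕ) :
    ‖riemann ν n (m + 1) - riemann ν n m‖ ≤ (3 : ℝ) ^ (-((m - padicValNat 3 n.factorial : ℕ) : ℤ)) := by
  rw [riemann_eq_sum_succ ν hν n m]
  unfold riemann
  rw [← Finset.sum_sub_distrib]
  refine IsUltrametricDist.norm_sum_le_of_forall_le_of_nonneg (by positivity) fun b _ ↦ ?_
  rw [← sub_mul, norm_mul]
  have hdvd := pow_dvd_choose_sub_choose n m (b := b) (b' := b % 3 ^ m) (Nat.mod_mod b (3 ^ m)).symm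
  have h1 : ‖(((b.choose n : ℕ) : ℂ_[3]) - (((b % 3 ^ m).choose n : ℕ) : ℂ_[3]))‖ ≤
      (3 : ℝ) ^ (-((m - padicValNat 3 n.factorial : ℕ) : ℤ)) := by
    have := norm_intCast_le_of_pow_dvd hdvd
    push_cast at this
    exact this
  calc ‖(((b.choose n : ℕ) : ℂ_[3]) - (((b % 3 ^ m).choose n : ℕ) : ℂ_[3]))‖ *
        ‖((ν (m + 1) b : unrIntegers 3) : ℂ_[3])‖
      ≤ (3 : ℝ) ^ (-((m - padicValNat 3 n.factorial : ℕ) : ℤ)) * 1 :=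
        mul_le_mul h1 (Summit.BirchSwinnertonDyer.Rank1Residual.X11b.Halves.norm_coe_unrIntegers_le_one 3 _)
          (norm_nonneg _) (by positivity)
    _ = _ := mul_one _

/-- **Tail bound**: `‖S_{m+k} − S_m‖ ≤ 3^{-(m − v₃(n!))}` for all `k`. [folklore] -/
theorem norm_riemann_add_sub_le (ν : ℕ → ℕ → unrIntegers 3) (hν : ν ∈ distributions (unrIntegers 3))
    (n m k : ℕ) :
    ‖riemann ν n (m + k) - riemann ν n m‖ ≤ (3 : ℝ) ^ (-((m - padicValNat 3 n.factorial : ℕ) : ℤ)) := by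
  induction k with
  | zero =>
      simp only [add_zero, sub_self, norm_zero]
      positivity
  | succ k ih =>
      have hstep := norm_riemann_succ_sub_le ν hν n (m + k)
      have hmono : (3 : ℝ) ^ (-((m + k - padicValNat 3 n.factorial : ℕ) : ℤ)) ≤
          (3 : ℝ) ^ (-((m - padicValNat 3 n.factorial : ℕ) : ℤ)) := by
        apply zpow_le_zpow_right₀ (by norm_num)
        omega
      calc ‖riemann ν n (m + (k + 1)) - riemann ν n m‖
          = ‖(riemann ν n (m + k + 1) - riemann ν n (m + k)) + (riemann ν n (m + k) - riemann ν n m)‖ := by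
            rw [sub_add_sub_cancel, ← add_assoc]
        _ ≤ max ‖riemann ν n (m + k + 1) - riemann ν n (m + k)‖ ‖riemann ν n (m + k) - riemann ν n m‖ :=
            IsUltrametricDist.norm_add_le_max _ _
        _ ≤ _ := max_le (hstep.trans hmono) ih

/-- The Riemann sums form a Cauchy sequence in `ℂ₃`. [folklore] -/
theorem cauchySeq_riemann (ν : ℕ → ℕ → unrIntegers 3) (hν : ν ∈ distributions (unrIntegers 3)) (n : ℕ) :
    CauchySeq (fun m ↦ riemann ν n m) := by
  refine Metric.cauchySeq_iff'.2 fun ε hε ↦ ?_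
  obtain ⟨k, hk⟩ : ∃ k : ℕ, ((1 : ℝ) / 3) ^ k < ε := exists_pow_lt_of_lt_one hε (by norm_num)
  refine ⟨padicValNat 3 n.factorial + k, fun m hm ↦ ?_⟩
  rw [dist_eq_norm]
  obtain ⟨j, rfl⟩ := Nat.exists_eq_add_of_le hm
  calc ‖riemann ν n (padicValNat 3 n.factorial + k + j) - riemann ν n (padicValNat 3 n.factorial + k)‖
      ≤ (3 : ℝ) ^ (-((padicValNat 3 n.factorial + k - padicValNat 3 n.factorial : ℕ) : ℤ)) :=
        norm_riemann_add_sub_le ν hν n _ j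
    _ = ((1 : ℝ) / 3) ^ k := by
        rw [show padicValNat 3 n.factorial + k - padicValNat 3 n.factorial = k by omega, zpow_neg, zpow_natCast,
          one_div, inv_pow]
    _ < ε := hk

/-- The `n`-th Mahler–Amice coefficient: the limit of the Riemann sums. -/
def coeffLim (ν : ℕ → ℕ → unrIntegers 3) (n : ℕ) : ℂ_[3] :=
  limUnder atTop (fun m ↦ riemann ν n m)

theorem tendsto_riemann (ν : ℕ → ℕ → unrIntegers 3) (hν : ν ∈ distributions (unrIntegers 3)) (n : ℕ) :
    Tendsto (fun m ↦ riemann ν n m) atTop (𝓝 (coeffLim ν n)) :=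
  tendsto_nhds_limUnder (cauchySeq_tendsto_of_complete (cauchySeq_riemann ν hν n))

/-- Integrality of the Mahler coefficients: `R₀` is closed in `ℂ₃`. [folklore] -/
theorem coeffLim_mem (ν : ℕ → ℕ → unrIntegers 3) (hν : ν ∈ distributions (unrIntegers 3)) (n : ℕ) :
    coeffLim ν n ∈ unrIntegers 3 :=
  isClosed_unrIntegers.mem_of_tendsto (tendsto_riemann ν hν n)
    (Eventually.of_forall fun m ↦ riemann_mem ν n m)

/-- **Kummer-type rate**: `‖c_n − S_m‖ ≤ 3^{-(m − v₃(n!))}`. [folklore] -/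
theorem norm_coeffLim_sub_riemann_le (ν : ℕ → ℕ → unrIntegers 3) (hν : ν ∈ distributions (unrIntegers 3))
    (n m : ℕ) :
    ‖coeffLim ν n - riemann ν n m‖ ≤ (3 : ℝ) ^ (-((m - padicValNat 3 n.factorial : ℕ) : ℤ)) := by
  have h1 : Tendsto (fun k ↦ riemann ν n (k + m)) atTop (𝓝 (coeffLim ν n)) :=
    (tendsto_add_atTop_iff_nat m).2 (tendsto_riemann ν hν n)
  have ht : Tendsto (fun k ↦ ‖riemann ν n (k + m) - riemann ν n m‖) atTop
      (𝓝 ‖coeffLim ν n - riemann ν n m‖) := (h1.sub_const _).norm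
  exact le_of_tendsto ht (Eventually.of_forall fun k ↦ by
    simpa only [add_comm k m] using norm_riemann_add_sub_le ν hν n m k)

theorem coeffLim_zero (n : ℕ) : coeffLim 0 n = 0 :=
  tendsto_nhds_unique (tendsto_riemann 0 (distributions (unrIntegers 3)).zero_mem n)
    (by simpa only [riemann_zero] using tendsto_const_nhds)

theorem coeffLim_add (ν ν' : ℕ → ℕ → unrIntegers 3) (hν : ν ∈ distributions (unrIntegers 3))
    (hν' : ν' ∈ distributions (unrIntegers 3)) (n : ℕ) :
    coeffLim (ν + ν') n = coeffLim ν n + coeffLim ν' n := by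
  refine tendsto_nhds_unique (tendsto_riemann _ ((distributions (unrIntegers 3)).add_mem hν hν') n) ?_
  have := (tendsto_riemann ν hν n).add (tendsto_riemann ν' hν' n)
  simpa only [riemann_add] using this

/-- **The Amice–Mahler transform** `𝒜 : distributions(R₀) →+ R₀⟦T⟧`, CONSTRUCTED: `[Tⁿ](𝒜 ν) = ∫ C(x,n) dν(x)`.
[folklore] [cite: Washington1997, §12.2] -/
def amice : distributions (unrIntegers 3) →+ UnrSeries 3 where
  toFun ν := PowerSeries.mk fun n ↦ ⟨coeffLim (ν : ℕ → ℕ → unrIntegers 3) n, coeffLim_mem _ ν.2 n⟩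
  map_zero' := by
    ext n
    rw [PowerSeries.coeff_mk, map_zero]
    simpa using coeffLim_zero n
  map_add' ν ν' := by
    ext n
    rw [PowerSeries.coeff_mk, map_add, PowerSeries.coeff_mk, PowerSeries.coeff_mk]
    simpa using coeffLim_add _ _ ν.2 ν'.2 n

theorem coe_coeff_amice (ν : distributions (unrIntegers 3)) (n : ℕ) :
    ((PowerSeries.coeff n (amice ν) : unrIntegers 3) : ℂ_[3]) = coeffLim (ν : ℕ → ℕ → unrIntegers 3) n := by
  simp only [amice, AddMonoidHom.coe_mk, ZeroHom.coe_mk, PowerSeries.coeff_mk]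

/-- **AmicePackaging** (leaf of v1, tag WEAKER — pure `3`-adic analysis, no curve): an ADDITIVE Amice–Mahler
transform `𝒜 : distributions(R₀) →+ R₀⟦T⟧` whose `n`-th coefficient is approximated by the level-`m` Riemann sums of
`x ↦ C(x,n)` to within `3^{-(m − v₃(n!))}`, for every `m`.  (The anticyclotomic dictionary — restriction to `ℤ₃^×`,
push-forward along `rec_𝔭̄`, the `𝔞`-shifts `[σ_𝔞]`, `γ ↦ 1+T` — is KJ′/EF bookkeeping, not part of this leaf.)
[folklore] [cite: Washington1997, §12.2] -/
def AmicePackaging : Prop :=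
  ∃ 𝒜 : distributions (unrIntegers 3) →+ UnrSeries 3,
    ∀ (ν : distributions (unrIntegers 3)) (n m : ℕ),
      ‖((PowerSeries.coeff n (𝒜 ν) : unrIntegers 3) : ℂ_[3]) -
          ∑ a ∈ range (3 ^ m), ((a.choose n : ℕ) : ℂ_[3]) *
            (((ν : ℕ → ℕ → unrIntegers 3) m a : unrIntegers 3) : ℂ_[3])‖
        ≤ (3 : ℝ) ^ (-((m - padicValNat 3 n.factorial : ℕ) : ℤ))

/-- **AmicePackaging holds** — the leaf is CLOSED in this node (`𝒜 := amice`). [this node] -/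
theorem amicePackaging : AmicePackaging :=
  ⟨amice, fun ν n m ↦ by
    rw [coe_coeff_amice]
    exact norm_coeffLim_sub_riemann_le _ ν.2 n m⟩

/-- **The canonical square-root functional of this node**: `Θ_ev := amice ∘ ballValues ev`; with it the line's F1 is
the DEFINITION `thetaOf ev amice`, and JC-as-series is `thetaOf_congr ev amice`. [this node] -/
def thetaAmice (ev : (ℕ → ℤ) →+ unrIntegers 3) : (ℕ → ℤ) →+ UnrSeries 3 := thetaOf ev amice

theorem thetaAmice_congr (ev : (ℕ → ℤ) →+ unrIntegers 3) {g g' : ℕ → ℤ} (h : ∀ k, (3 : ℤ) ∣ g k - g' k) :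
    ∀ i, ‖((PowerSeries.coeff i (thetaAmice ev g - thetaAmice ev g') : unrIntegers 3) : ℂ_[3])‖ < 1 :=
  thetaOf_congr ev amice h

end Amice

/-! ### §6 Sanity examples (the definitions compute) -/

example : trunc 1 1 (fun k ↦ (k : ℤ)) 4 = 4 := by simp [trunc_apply]
example : trunc 1 1 (fun k ↦ (k : ℤ)) 5 = 0 := by simp [trunc_apply]
example : theta 2 (fun _ ↦ (1 : ℤ)) 3 = 9 := by simp [theta_apply]

end Summit.BirchSwinnertonDyer.BirchSwinnertonDyer.Cruxes.SigmaCongruenceAtThree.TwistTruncationMeasure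

end
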